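import Mathlib
import HarnessLib
import HarnessLib.Audit
import Summits.NavierStokesRegularity.Statement
import Literature.Analysis.FluidPDE.Tao2016AveragedNS.BoundedEternalSolutions
import Summits.NavierStokesRegularity.NavierStokesRegularity.Theses.TaoLadderRungTwoBreak
import HarnessLib.Audit.Status.Attr

/-!
Route: WakeRatchet

# Route WakeRatchet — tail-energy envelope of bounded eternal cascade solutions ratchets down per
shell on comparable tables

D-0145 LINE (ideator ns-idea-1 g0, technique card «monotone quantity hunt»; bears_on rung TL-M2Break
=
`TaoLadderRungTwoBreak.Target`, the MODEL-LATTICE break point BP-D-latt of Tao 2016 §4 — nothing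
here is a
statement about the Navier–Stokes equations and no summit is proved by this line). It suffices to
show X =
TailRatchet ∧ EternalRigidityViscBddOne. THE MONOTONE QUANTITY: for a uniformly bounded admissible
eternal
solution W of the renormalised lattice (any covariant viscosity ν̂ ≥ 0) on an R-comparable table,
the
TAIL-ENERGY ENVELOPE n ↦ Θ_n := sup_σ Σ_{k ≥ n} E_k(σ) (E_k = physEnergy). Θ_{n+1} ≤ Θ_n is FREE
(tails nest);
the deciding crux TailRatchet is the spread-uniform STRICT contraction Θ_{n+1} ≤ (1 − w(R))·Θ_n for
all
ε₀ ≤ ε_s(R) — equivalently, every shell strands (or dissipates) a fraction ≥ w of all the energy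
that ever
reaches its tail (the WAKE FLOOR, typed). The supports TailEnvelopeFinite (Θ_n < ∞, tail energy
balance) and
RatchetStarvation (contraction with (1+ε₀)(1−w) < 1 ⇒ ¬EternalSurvivingFwd 1, bookkeeping) turn it
into the
parent route's K1ᵛ NoSurvivingEternalViscBddOne (stmt-20419) INCLUDING both split children ρ0
(20451) and ρ+
(20452) at once; the tree glue `noRobustBlowupBelow_of_eternalViscBdd` with the shared extraction
crux K2ᵛ
EternalRigidityViscBddOne (stmt-20420) gives the rung leaf.
Lean: `Summit.NavierStokesRegularity.NavierStokesRegularity.Theses.WakeRatchet.TailRatchet ∧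
Summit.NavierStokesRegularity.NavierStokesRegularity.Theses.WakeRatchet.EternalRigidityViscBddOne`

## Assembly
Pure logic over the route's own items plus ONE tree glue theorem, certified in the planner's
line1/Sketch.lean and glue.lean
(lean check rc 0, 0 sorry; `ledger route check --native` verdict OK): fix R ≥ 1; TailRatchet gives
(w, ε_s); set ε' :=
min(ε_s, w/2), so that for ε₀ ≤ ε' one has (1+ε₀)(1−w) ≤ (1 + w/2)(1 − w) < 1; for such ε₀, any
table in InTableClass R
(cancelling, so TailEnvelopeFinite applies) and any bounded admissible eternal solution,
RatchetStarvation gives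
¬EternalSurvivingFwd 1 — this is `NoSurvivingEternalViscBdd R 1`;
`TaoCascade.noRobustBlowupBelow_of_eternalViscBdd` with
EternalRigidityViscBddOne R gives `NoRobustBlowupBelow R`, i.e. the rung leaf
`TaoLadderRungTwoBreak.Target` (closes rung
TL-M2Break, D-0061; NOT the summit). Deciding theorem: `closes : TailRatchet → TailEnvelopeFinite →
RatchetStarvation →
EternalRigidityViscBddOne → TaoLadderRungTwoBreak.Target`.

CLOSES_TARGET: closes rung TL-M2Break of NavierStokesRegularity: Summit.NavierStokesRegularity.NavierStokesRegularity.Theses.TaoLadderRungTwoBreak.Target (D-0061; not the summit Statement) — the deciding theorem of this route concludes that registered leaf instead of the Statement decl `NavierStokesRegularity` (class rung: servable and labelled, never counted as concluding the summit Statement).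

Rationale: WHY THIS LINE. The parent route TaoLadderRungTwoBreak records «NOT DECOMPOSED YET: the analytic
heart of (ρ0) — why a bounded
inviscid eternal solution on a fixed-spread table must shed a wake fraction ≥ c(R) > 0 per shell —
desk
heuristics only»; this line TYPES that heart as a one-step inequality for a quantity whose
monotonicity is
free, and makes it the deciding obligation. The lever is the cell's own dissipation-range device run
into the
inertial range: the tree theorem `TaoCascade.physEnergy_succ_le` (Tao2016AveragedNS §4 Lemma 4.1
shape) is an
envelope step «E_N ≤ S at all log-times ⇒ E_{N+1} ≤ Θ_N(S)» contracting only above the dissipation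
cutoff
(PROVED seeded slice `noSurvivingViscSeededBdd R 4096`); the bet is that on R-COMPARABLE tables the
TAIL
envelope contracts LINEARLY, Θ_{n+1} ≤ (1−w)Θ_n, below the cutoff and at ν̂ = 0, because comparable
couplings
(every non-zero structure constant in [R⁻¹, 1]) can neither delay the onward transfer n+1 → n+2
while n → n+1
completes nor re-absorb the stranded remainder (the Dombre–Gilson travelling-front picture of
shell-model
blow-up, doi:10.1016/s0167-2789(97)80015-2, arXiv:1201.1631, arXiv:2501.07377, where every known
front leaves
an infrared power-law wake). A Lyapunov quantity in the SHELL INDEX rather than in time is chosen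
deliberately: the inviscid quadratic lattice is time-reversible, so no even functional of the state
is
time-monotone, whereas tail energies nest for every orientation; and the TAIL (not the single-shell
peak) is
chosen because pulsating fronts (Hopf-bifurcated blow-up, doi:10.1088/0951-7715/26/4/1105) can pile
one
shell's peak above its predecessor's while tails still nest. Imported area: travelling fronts in
lattice
dynamical systems / shell-model renormalisation (physics of turbulence); nothing from NS analysis.
Versus the
listed routes: TaoLadderRungTwoBreak attacks ρ0/ρ+ separately (inviscid Liouville by continuum-limit
solitary-wave non-existence; loud ladders by BMR-type positivity), TaoLadderRungTwo/Three/Poly are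
POSITIVE
certificate routes (gap certificates for fronts); none states a per-shell envelope contraction, and
the
negatives index (5 NS entries) has no lattice statement.

RANKED CRUXES. #2 TailRateRatchet (crux, stmt-NavierStokesRegularity-25584; REPAIRED deciding crux
since rev 6, 2026-08-28, planner ns-idea-1 g4 acting on the prover DECISION MEMO
brief_21808_repair.md) — RATE tail ratchet: for every spread R ≥ 1 there are a = a(R) > 1 and ε_s >
0 such that for all ε₀ ∈ (0, ε_s], every table α ∈ InTableClass R (m = 4), every ν̂ and every
admissible eternal solution W with IsEternalVisc ε₀ ν̂ α W and UniformBound W, and every shell n: if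
the tail energy Σ_{k≥0} E_{n+k}(σ) is ≤ M at ALL log-times σ, then the next tail Σ_{k≥0}
E_{n+1+k}(σ) is ≤ (1+ε₀)^(−a)·M at all log-times — the envelope contracts per shell STRICTLY FASTER
than the a = 1 survival weight, which is all the starvation glue consumes ((1+ε₀)(1−w) < 1 with w :=
1 − (1+ε₀)^(−a); deciding theorem re-glued verbatim from the landed helper
`Theorems.WakeRatchetRate.target_of_rateRatchet`, p590528). Consistent with every computed
fixed-spread front: Kolmogorov rate a = 5/3 is sharp on the dyadic member (exact DSS fronts down to
ε₀ = 0.003: 1 − μ ≈ 1.66·ε₀, prover evidence_21808_dyadic_kappa.md), Tao circuit (1,1,1,1,1) exact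
DSS fronts with μ ≈ Λ^(−2/3), static cascades of ANY cancelling table g³ = Λ²
(evidence_21808_K41_universality.md). [difficulty: XL] (why it might fail: a fixed-spread table may
carry bounded eternal fronts with SUB-KOLMOGOROV per-shell retention μ(ε₀) ≥ (1+ε₀)^(−a) for every a
> 1 as ε₀ → 0 — front velocity exponent y ≤ 1/5 in the W = 5y dictionary (no known shell-model
exponent is near it: Sabra y ≈ 0.28) — or a chaotic non-DSS eternal solution (arXiv:2501.07377 p.20)
may retain more along sparse shells; the negative-modulo-H shape is landed:
`not_rateRatchet_of_persistent_fast_fronts` (Theorems/WakeRatchetTailRatchetDSSVisc).)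
[Tao2016AveragedNS, arXiv:1402.0290, arXiv:2501.07377, arXiv:1201.1631, BarbatoMorandinRomito2011,
doi:10.1088/0951-7715/26/4/1105]
#2′ TailRatchet (stmt-NavierStokesRegularity-21808; rev-0 crux of record until rev 5, NOW ASIDE —
banked negative knowledge, never staffed): the UNIFORM-FRACTION ratchet (∃ w(R) > 0: contraction by
1 − w per shell, ε₀-uniform). Dead modulo the construction item DyadicScalarFronts (p589335,
--negative-modulo): on the DSS stratum the uniform fraction is a Liouville claim
(`WakeRatchetTailRatchetDSS`: delay kinematics force dssMu > (1+ε₀)^(−5) → 1), and the dyadic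
member's exact DSS fronts retain 1 − μ ≈ 1.66·ε₀ → 0 at fixed spread 2 (kernel kill criteria +
numerics, prover ns-wake-p1 g0/g2); `rateRatchet_of_tailRatchet` (p590528) records that the rate
form is a consequence of it. Kept in the file as the settled edge; its registered skeleton
Cruxes/TailRatchet/Lines/birth.lean is superseded by the rate-form skeleton attached to 25584.
#3 EternalRigidityViscBddOne (crux) — SHARED with TaoLadderRungTwoBreak.EternalRigidityViscBddOne
(stmt-NavierStokesRegularity-20420), verbatim: for every R ≥ 1, below a threshold, robust blow-up
(NoGlobalCascade ε₀ α X₀) of a table α ∈ InTableClass R from a one-shell datum yields ν̂ ≥ 0 and a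
uniformly bounded admissible viscous eternal solution surviving forward at a = 1 (the ω-limit of the
type-I-renormalised blow-up trajectory). Model lattice only. [difficulty: XL] (why it might fail:
Sub-threshold robust blow-up on an E₂(R) table may be type-II or chaotic in log-time (non-DSS
Sabra-type attractors, arXiv:2501.07377 p.20): then no bounded rescaling limit exists and the
extraction is empty.) [Tao2016AveragedNS, KochNadirashviliSereginSverak2009, arXiv:2501.07377,
arXiv:1201.1631]
#9 TailEnvelopeFinite (support) — for every admissible eternal solution W (IsEternalVisc ε₀ ν̂ α W,
0 < ε₀) with UniformBound on a CANCELLING table, every tail energy Σ_{k≥0} E_{n+k}(σ) is bounded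
uniformly in σ. Proof route (M-sized real analysis): the finite tail Σ_{k=n}^{K} E_k has derivative
F_{n−1} − F_K − dissipation (`hasDerivAt_physEnergy`); |F_K(σ)| ≤ c·Λ^{−2K}e^{2σ}C³ → 0
(UniformBound); forward, |F_{n−1}(σ)| ≤ c'e^{−σ} by `IsEternalVisc.bdd` at shells n−1, n; backward,
the tail is ≤ e^{2σ}C²Λ^{−2n}/(1 − Λ^{−2}). [difficulty: M] [Tao2016AveragedNS, arXiv:1402.0290]
#9 RatchetStarvation (support) — a=1 bookkeeping, provable now: if an admissible eternal solution W
(IsEternalVisc ε₀ ν̂ α W, UniformBound W) has finite tail envelopes and the tail contraction of crux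
2 at some w > 0 with (1+ε₀)(1−w) < 1, then W is not forward (S₁)-surviving. Proof sketch: Θ_0 := the
bound at shell 0; induction on j ≥ 0 gives Σ_k E_{j+k} ≤ (1−w)^j Θ_0 at all σ; E_j ≤ its tail
(summable by UniformBound, terms ≥ 0); the weighted energy p_j = (1+ε₀)^j E_j (`wtEnergy_eq`) is ≤
((1+ε₀)(1−w))^j Θ_0 → 0, contradicting EternalSurvivingFwd 1 (a level c > 0 reached at arbitrarily
high shells). [difficulty: provable-now] [Tao2016AveragedNS, arXiv:1402.0290]

TWO-LAYER PLAN. Foreseen glued split of TailRateRatchet by dissipation level (mirrors the parent's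
ρ0/ρ+): C_inv (ν̂ = 0, IsEternal; ∃ a₀ > 1) → C_visc
(ν̂ > 0; ∃ a₁ > 1) → TailRateRatchet with a := min a₀ a₁ (case split on `IsEternalVisc.nonneg`,
`isEternalVisc_zero_iff`, monotonicity of (1+ε₀)^(−a) in a), kernel-checked as the BC3 skeleton
wr/TailRateRatchet_birth.lean (stub_inviscid, stub_viscous, composition `TailRateRatchet_of`
sorry-free; plus the plan-only BC5 rung stub_rung_dss = the crux on exact DSS fronts
W_{n+1}(σ) = W_n(σ − T): dssMu ≤ (1+ε₀)^(−a), i.e. the Dombre–Gilson front exponent stays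
super-critical, technique: delay-profile energy identity + the static-cascade algebra g³ = Λ²). A
second
foreseen split of C_inv: KOLMOGOROV AFTERGLOW (behind any front the tail relaxes to the
constant-flux profile, rate exactly a = 5/3) + FRONT SELECTION (the discrete front's retention
exponent is > 1, numerically ≥ 1.23 and → 5/3). Nothing of this is filed now.

KILL CRITERIA. Refuted outright (close --reason refuted:TailRateRatchet, or repair to the block
form) by ONE spread R and a sequence ε₀ → 0 of R-comparable tables
carrying bounded admissible eternal solutions whose tail envelopes satisfy Θ_{n+1}/Θ_n ≥ (1+ε₀)^(−a)
for every a > 1 along some shells — e.g. exact DSS fronts with per-shell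
retention 1 − dssMu ≤ (1 + o(1))·ε₀ on a FIXED-spread table (a marginal or surviving front; the
parent dies with it only if μ ≥ (1+ε₀)^(−1) along the sequence:
`not_rateRatchet_of_persistent_fast_fronts`), or a chaotic
front with a sparse sequence of asymptotically retention-free shells. Mooted if
TaoLadderRungTwo.Target is proved (then TL-M2Break is false: `not_rungTwoLatt_of_target`). Pivot if
only sparse shells bite: re-type as a BLOCK
rate ratchet (Θ_{n+N} ≤ (1+ε₀)^(−aN)Θ_n for a spread-uniform N(R); the starvation glue survives) — a
new item, not an edit in place. History: rev-0 TailRatchet (uniform fraction) met exactly the first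
kill criterion of rev 0 (dyadic DSS fronts, μ → 1) and was retired to aside at rev 6.

NOT DECOMPOSED YET. The mechanism of the Kolmogorov-rate wake inside one hop (window lemma;
continuum-limit λ → 1⁺ compactness of a single hop, where the static-cascade algebra g³ = Λ² fixes
the rate 5/3;
the role of the cancellation (4.3) and of the comparability floor R⁻¹ in forbidding both delayed
transfer and re-absorption of the stranded remainder); the dependence a(R) (expected → 5/3⁻ for
every R, with ε_s(R) → 0);
whether the block form is what is actually true for chaotic fronts.

CHEAPEST FALSIFIER. INSTRUMENT ROW (prover ns-wake-p1's DSS-front solver for fixed-spread tables,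
evidence_21808_dyadic_kappa.md / evidence_21808_K41_universality.md; the cell's lattice integrator
kit j280208 / j280330 / j281581 family):
κ₀(table) := lim_{ε₀→0} (1 − dssMu)/ε₀ over the exact DSS fronts of a FIXED-spread table must stay >
1 on every comparable table (dyadic: 1.66 ≈ 5/3; Tao circuit (1,1,1,1,1): 5/3·(1+o(1))); κ₀ ≤ 1 on
one table kills
crux 2 (and κ₀ < 1 kills the rung's belief via a surviving front). Second cheapest: the retention of
chaotic (non-DSS) bounded eternal fronts of the seeded Tao circuit (q = 0.01; K41 on average per the
prover) along sparse shells.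

Novelty: Searches (2026-08-27): lit search --hybrid "shell model energy cascade self-similar blow-up front
energy loss per shell" (10 docs: Frisch1995 pp.130/99, Bohr–Jensen–Paladin–Vulpiani 1998 pp.52–53,
Ditlevsen2010 p.155 — shell-model phenomenology, no envelope theorem); lit vsearch "<front leaves a
fixed fraction per step, Lyapunov in shell index>" (same books; no hit states a per-hop
contraction); lit search "Mailybaev renormalization universality blowup shell model"
([corpus:arxiv-2501.07377 p.5–9] Dombre–Gilson renormalisation: self-similar blow-up = travelling
wave, exponent by a nonlinear eigenvalue problem, non-unique profiles; [graph:arxiv:1201.1631];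
[graph:doi:10.1016/s0167-2789(97)80015-2]); lit galaxy search "dyadic model|shell model
blow-up|self-similar cascade" --star all and "dyadic model" --star pdf: no relevant hits (noise
only); doi:10.1088/0951-7715/26/4/1105 (Mailybaev, bifurcations of blow-up in inviscid shell models:
periodic/quasi-periodic/chaotic fronts — the reason for the tail, not peak, envelope). Tree: `lean
search physEnergy_succ_le` (the dissipation-range envelope step), route files
TaoLadderRungTwoBreak/Two/Three/Poly read.
Nearest prior art found: Tao2016AveragedNS §4 Lemma 4.1/Thm 4.2 (the envelope step in the
dissipation range, tree theorem `physEnergy_succ_le`); Dombre–Gilson 1998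
doi:10.1016/s0167-2789(97)80015-2 and arXiv:2501.07377 (travelling-front renormalisation of
shell-model blow-up, wake exponent as eigenvalue, per model, numerically);  [refs: 10.1016/s0167-2789(97, 10.1088/0951-7715/26/4/1105, 1201.1631, 2501.07377, arxiv-2501.07377, arxiv:1201.1631, doi:10.1016/s0167-2789, doi:10.1088/0951-7715/26/4/1105, Frisch1995, Ditlevsen2010]

Barriers (technique_class: shell-index-lyapunov, envelope-recursion): - technique_class: shell-index-lyapunov, envelope-recursion
- Literature.Barriers.NavierStokesRegularity.TaoAveragedBlowup: outside — Tao's blow-up table has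
spread ≍ ε⁻²e^(K¹⁰) → ∞ as ε₀ → 0; the crux quantifies only over InTableClass R at fixed R and small
ε₀, where the barrier asserts nothing.
- Literature.Barriers.NavierStokesRegularity.AveragedTypeIBlowup: outside for the same reason
(type-I averaged blow-up lives on the hierarchical table); the crux is the statement that comparable
tables cannot host its renormalised limit.
- Literature.Barriers.NavierStokesRegularity.DyadicCascadeRegularity: consistent — at m = 1 (BMR
2011) viscosity wins, the envelope contracts; the crux is its m = 4 sign-indefinite analogue and
does not use positivity.
- Literature.Barriers.NavierStokesRegularity.TruncatedDyadicBlowup: not applicable — truncation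
artefacts concern finite lattices; the crux is about eternal solutions of the full lattice.
- Literature.Barriers.NavierStokesRegularity.EnergySupercriticality: not an NS statement; on the
lattice the tail envelope Θ_n is scale-covariant (physEnergy carries the Λ^(−2n) weight), so the
supercriticality heuristic does not bite a per-shell ratio.
- Negatives index: the 5 NS entries (OddMorawetzLocal, FiniteTangentModuli, PerpetualPump.Thesis,
CorrectorSolvable, BlowupClayNonuniqueness) contain no lattice statement; PerpetualPump's proved
CircuitPump (the seeded Toda pump) is the named enemy and lives at spread → ∞, outside InTableClass
R at sma

History (route lifecycle, newest last):
- 2026-08-27T21:14:00Z · rev 1: restated TailRatchet (stmt-NavierStokesRegularity-21808) — pre-emptive weakening per critic P0 (idea-crit-3 21:10Z): TailRatchet now carries the hypothesis EternalSurvivingFwd 1 ε₀ W; closes re-glued by contradiction (R (planner-ns-idea-1-g0-0)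
- 2026-08-27T22:11:21Z · rev 2: informal re-worded for TailRatchet (planner-ns-idea-1-g0-0)
- 2026-08-27T23:27:16Z · rev 5: dropped stmt-NavierStokesRegularity-23623, stmt-NavierStokesRegularity-23625 — planner cleanup: two accidental probe items (signature 'x' / 'True', created 23:25–23:26Z by a mistyped CLI check) dropped; they are not statements; the intende (planner-ns-idea-1-g2-0)

sub-problem: NavierStokesRegularity · status: open · opened planner-ns-idea-1-g0-0 2026-08-27T20:24:24Z · rev 9 · ledger route-NavierStokesRegularity-WakeRatchet
GENERATED by the gate from the ledger (D-0016/17). Provers cite these decls: `theorem foo : Summit.NavierStokesRegularity.NavierStokesRegularity.Theses.WakeRatchet.<Decl> := …` in Summits/NavierStokesRegularity/NavierStokesRegularity/Theorems/<Name>.lean.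
-/

namespace Summit.NavierStokesRegularity.NavierStokesRegularity.Theses.WakeRatchet

open scoped BigOperators Topology Manifold Classical MeasureTheory ProbabilityTheory Matrix InnerProductSpace ComplexConjugate ContinuousMap
open Filter Set Function TopologicalSpace MeasureTheory

attribute [summit_statement] _root_.NavierStokesRegularity
attribute [summit_statement] _root_.Summit.NavierStokesRegularity.NavierStokesRegularity.Theses.TaoLadderRungTwoBreak.Target

open Literature.NS

/-- item stmt-NavierStokesRegularity-25584 · crux · rank 2 · SPLIT (gen 1) into EternalInviscidRate, EternalViscousRate + glue TailRateRatchetOfDissipationSplit · direct attempts still welcome (low priority) · by planner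
why it might fail: Fixed-spread tables may carry bounded eternal fronts with sub-Kolmogorov retention μ(ε₀) ≥ (1+ε₀)^(−a) for every a>1 as ε₀→0 (front exponent y ≤ 1/5; dyadic fronts: 1−μ ≈ 1.66ε₀, so a < 5/3 is forced), or chaotic non-DSS eternal solutions (arXiv:2501.07377) may retain more.
sources: Tao2016AveragedNS, arXiv:1402.0290, arXiv:2501.07377, arXiv:1201.1631, BarbatoMorandinRomito2011, doi:10.1088/0951-7715/26/4/1105
[crux] RATE TAIL RATCHET (repaired form of TailRatchet stmt-21808, planner ns-idea-1 g4 after the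
prover DECISION MEMO brief_21808_repair.md): for every spread R ≥ 1 there are a RATE a = a(R) > 1
and ε_s > 0 such that for all ε₀ ∈ (0, ε_s], every table α ∈ InTableClass R (m = 4), every ν̂ and
every admissible eternal solution W (IsEternalVisc ε₀ ν̂ α W, UniformBound W) and every shell n: if
the tail energy Σ_{k≥0} E_{n+k}(σ) is ≤ M at all log-times σ then the next tail Σ_{k≥0} E_{n+1+k}(σ)
is ≤ (1+ε₀)^(−a)·M at all log-times — the tail envelope contracts per shell STRICTLY FASTER than the
a = 1 survival weight (which is all RatchetStarvation consumes: (1+ε₀)(1−w) < 1 with w := 1 −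
(1+ε₀)^(−a)); consistent with every computed fixed-spread front (Kolmogorov rate a = 5/3, sharp on
the dyadic member: 1 − μ ≈ 1.66·ε₀; Tao circuit (1,1,1,1,1): μ ≈ Λ^(−2/3)); glue
`Theorems.WakeRatchetRate.target_of_rateRatchet` (p590528) closes the rung with the other three
items unchanged; `rateRatchet_of_tailRatchet` shows it is a weakening of 21808. Why it might fail: a
fixed-spread table may carry bounded eternal fronts with sub-Kolmogorov retention μ(ε₀) ≥
(1+ε₀)^(−a) for every a > 1 as ε₀ → 0 (fron -/
@[route_item "route-NavierStokesRegularity-WakeRatchet", crux]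
def TailRateRatchet : Prop :=
  ∀ R : ℝ, 1 ≤ R → ∃ a : ℝ, 1 < a ∧ ∃ εs : ℝ, 0 < εs ∧ ∀ ε₀ : ℝ, 0 < ε₀ → ε₀ ≤ εs → ∀ α : Fin 4 → Fin 4 → Fin 4 → ℤ × ℤ × ℤ → ℝ, Literature.Analysis.FluidPDE.TaoCascade.InTableClass R α → ∀ (νh : ℝ) (W : ℤ → ℝ → Literature.Analysis.FluidPDE.TaoCascade.Em 4), Literature.Analysis.FluidPDE.TaoCascade.IsEternalVisc ε₀ νh α W → Literature.Analysis.FluidPDE.TaoCascade.UniformBound W → ∀ (n : ℤ) (M : ℝ), (∀ σ : ℝ, ∑' k : ℕ, Literature.Analysis.FluidPDE.TaoCascade.physEnergy ε₀ W (n + k) σ ≤ M) → ∀ σ : ℝ, ∑' k : ℕ, Literature.Analysis.FluidPDE.TaoCascade.physEnergy ε₀ W (n + 1 + k) σ ≤ (1 + ε₀) ^ (-a) * M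

-- parent: TailRateRatchet · child (gen 1)
/--     item stmt-NavierStokesRegularity-25646 · crux · rank 201 · open
    parent: TailRateRatchet · by planner
    why it might fail: A fixed-spread table may carry bounded inviscid eternal fronts with sub-Kolmogorov retention μ(ε₀) ≥ (1+ε₀)^(−a) for all a>1 as ε₀→0 (front exponent y ≤ 1/5; dyadic: 1−μ ≈ 1.66ε₀ forces a₀ < 5/3), or chaotic non-DSS eternal solutions (arXiv:2501.07377) retaining more.
    sources: Tao2016AveragedNS, arXiv:1402.0290, arXiv:2501.07377, arXiv:1201.1631, BarbatoMorandinRomito2011, doi:10.1088/0951-7715/26/4/1105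
[crux, LINE g4-2 of ideator ns-idea-1 (technique: monotone quantity), split child (A) of the
repaired deciding crux TailRateRatchet = stmt-NavierStokesRegularity-25584; the ANALYTIC HEART]
INVISCID RATE RATCHET: for every spread R ≥ 1 there are a₀ = a₀(R) > 1 and ε_s > 0 such that for ε₀
≤ ε_s, every table α ∈ E₂(R) (m = 4) and every uniformly bounded admissible INVISCID eternal
solution W (IsEternal ε₀ α W, UniformBound W): a bound M on the tail energy Σ_{k≥0} E_{n+k}(σ) at
all log-times forces the bound (1+ε₀)^(−a₀)·M on the next tail Σ_{k≥0} E_{n+1+k}(σ) at all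
log-times. This is the ν̂ = 0 slice of the parent (parent ⇒ child: `inviscid_of_parent`, folder
line2/split_probe.lean) and carries the Kolmogorov-rate content: on exact DSS fronts it says dssMu ≤
(1+ε₀)^(−a₀) (numerically 1 − μ ≈ 1.66·ε₀ on the dyadic member, μ ≈ Λ^(−2/3) on the Tao circuit; the
static-cascade algebra g³ = Λ² of every cancelling table fixes the continuum rate 5/3). MODEL
lattice only; nothing about NS. CHEAPEST FALSIFIER / INSTRUMENT ROW: κ₀(table) := lim_{ε₀→0}(1 −
dssMu)/ε₀ over exact DSS fronts of a FIXED-spread table (prover ns-wake-p1 DSS solver) must stay >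
1; κ₀ ≤ 1 on one comparable table kills i -/
@[route_item "route-NavierStokesRegularity-WakeRatchet"]
def EternalInviscidRate : Prop :=
  ∀ R : ℝ, 1 ≤ R → ∃ a : ℝ, 1 < a ∧ ∃ εs : ℝ, 0 < εs ∧ ∀ ε₀ : ℝ, 0 < ε₀ → ε₀ ≤ εs → ∀ α : Fin 4 → Fin 4 → Fin 4 → ℤ × ℤ × ℤ → ℝ, Literature.Analysis.FluidPDE.TaoCascade.InTableClass R α → ∀ W : ℤ → ℝ → Literature.Analysis.FluidPDE.TaoCascade.Em 4, Literature.Analysis.FluidPDE.TaoCascade.IsEternal ε₀ α W → Literature.Analysis.FluidPDE.TaoCascade.UniformBound W → ∀ (n : ℤ) (M : ℝ), (∀ σ : ℝ, ∑' k : ℕ, Literature.Analysis.FluidPDE.TaoCascade.physEnergy ε₀ W (n + k) σ ≤ M) → ∀ σ : ℝ, ∑' k : ℕ, Literature.Analysis.FluidPDE.TaoCascade.physEnergy ε₀ W (n + 1 + k) σ ≤ (1 + ε₀) ^ (-a) * M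

-- parent: TailRateRatchet · child (gen 1)
/--     item stmt-NavierStokesRegularity-25647 · crux · rank 202 · open
    parent: TailRateRatchet · by planner
    why it might fail: A dissipation-balanced (ν̂>0) bounded eternal front could sit at the survival borderline: the receding dissipation range returns nothing to lower shells, so if the inviscid wake rate a₀(R)→1⁺ the viscous slice may reach retention (1+ε₀)^(−1) first; no such profile is known (BMR11/CZ16: base 2 only).
    sources: Tao2016AveragedNS, arXiv:1402.0290, arXiv:2501.07377, arXiv:1201.1631, BarbatoMorandinRomito2011, doi:10.1088/0951-7715/26/4/1105
[crux, LINE g4-2 of ideator ns-idea-1, split child (B) of TailRateRatchet =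
stmt-NavierStokesRegularity-25584; the DISSIPATION-BALANCED slice] VISCOUS RATE RATCHET: the same
tail-envelope contraction by (1+ε₀)^(−a₁), a₁ = a₁(R) > 1, for every uniformly bounded admissible
eternal solution with covariant renormalised viscosity ν̂ > 0 (IsEternalVisc ε₀ ν̂ α W with 0 < ν̂:
the viscous coefficient ν̂(1+ε₀)^{2n}e^{−σ} is the profile of a blow-up running exactly on the
dissipation clock). By log-time translation covariance (tree: `IsEternalVisc.translate`,
`exists_surviving_visc_rescale`, `noSurvivingVisc_large_iff_pos`) the slice ν̂ = 1 is the whole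
statement; forward in σ the dissipation fades at rate e^{−σ}, backward it empties every fixed shell,
so W enters from n = −∞ — the child isolates the interaction of the Kolmogorov-rate wake with a
receding dissipation range (expected no harder than (A) plus the tree's dissipation-range envelope
`physEnergy_succ_le`). Parent ⇒ child (`viscous_of_parent`); children ⇒ parent is the generated
glue, PROVED sorry-free in folder line2/split_probe.lean `tailRateRatchet_of_split` (a := min a₀ a₁,
case split on IsEternalVisc.nonneg / isEternalVisc_zero -/
@[route_item "route-NavierStokesRegularity-WakeRatchet"]
def EternalViscousRate : Prop :=
  ∀ R : ℝ, 1 ≤ R → ∃ a : ℝ, 1 < a ∧ ∃ εs : ℝ, 0 < εs ∧ ∀ ε₀ : ℝ, 0 < ε₀ → ε₀ ≤ εs → ∀ α : Fin 4 → Fin 4 → Fin 4 → ℤ × ℤ × ℤ → ℝ, Literature.Analysis.FluidPDE.TaoCascade.InTableClass R α → ∀ (νh : ℝ) (W : ℤ → ℝ → Literature.Analysis.FluidPDE.TaoCascade.Em 4), 0 < νh → Literature.Analysis.FluidPDE.TaoCascade.IsEternalVisc ε₀ νh α W → Literature.Analysis.FluidPDE.TaoCascade.UniformBound W → ∀ (n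 : ℤ) (M : ℝ), (∀ σ : ℝ, ∑' k : ℕ, Literature.Analysis.FluidPDE.TaoCascade.physEnergy ε₀ W (n + k) σ ≤ M) → ∀ σ : ℝ, ∑' k : ℕ, Literature.Analysis.FluidPDE.TaoCascade.physEnergy ε₀ W (n + 1 + k) σ ≤ (1 + ε₀) ^ (-a) * M

-- parent: TailRateRatchet · glue (gen 1)
/--     item stmt-NavierStokesRegularity-25648 · support · rank 203 · closed · proved by Summit.NavierStokesRegularity.NavierStokesRegularity.Theorems.wakeRatchet_tailRateRatchetOfDissipationSplit_proof (prover)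
    parent: TailRateRatchet · GLUE: children ⟹ parent · by planner
INVISCID/VISCOUS SPLIT of the repaired deciding crux TailRateRatchet (stmt-25584) by ideator
ns-idea-1 LINE g4-2: EternalInviscidRate → EternalViscousRate → TailRateRatchet. PROVABLE NOW
(folder line2/split_probe.lean tailRateRatchet_of_split, kernel-checked, sorry-free): intro both; a
:= min a₀ a₁, ε_s := min; M ≥ 0 from physEnergy_nonneg/tsum_nonneg; case split on
IsEternalVisc.nonneg — ν̂ = 0 via isEternalVisc_zero_iff to child (A), ν̂ > 0 to child (B);
monotonicity Real.rpow_le_rpow_of_exponent_le in the exponent. Model lattice only; nothing about NS. -/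
@[route_item "route-NavierStokesRegularity-WakeRatchet"]
def TailRateRatchetOfDissipationSplit : Prop :=
  EternalInviscidRate → EternalViscousRate → TailRateRatchet

-- `TailRateRatchetOfDissipationSplit` holds: proved by `Summit.NavierStokesRegularity.NavierStokesRegularity.Theorems.wakeRatchet_tailRateRatchetOfDissipationSplit_proof` (its module imports this route file, so no `_holds` link can be stated here).

/-- item stmt-NavierStokesRegularity-20420 · crux · rank 3 · SPLIT (gen 1) into AdmissibleEternalBound, EternalRigidityViscOne + glue EternalRigidityViscBddOneOfActionSplit · direct attempts still welcome (low priority) · by planner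
why it might fail: Sub-threshold robust blow-up on an E₂(R) table may be type-II or chaotic in log-time (non-DSS Sabra-type attractors, arXiv:2501.07377 p.20): then no bounded rescaling limit exists and the extraction is empty.
sources: Tao2016AveragedNS, KochNadirashviliSereginSverak2009, arXiv:2501.07377, arXiv:1201.1631
[crux, consequence-crux consumed by closes] K2ᵛ(1): for every R ≥ 1 there is a threshold below which
robust blow-up (NoGlobalCascade ε₀ α X₀) of a table α ∈ InTableClass R from a one-shell datum yields
ν̂ ≥ 0 and a uniformly bounded admissible viscous eternal solution W (IsEternalVisc ε₀ ν̂ α W ∧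
UniformBound W) surviving forward at a = 1 — the ω-limit of the type-I-renormalised blow-up
trajectory modulo shell shift. Implied by the Target (vacuously) and by rev-1's BlowupRigidityOne.
Model lattice ODEs only. -/
@[route_item "route-NavierStokesRegularity-WakeRatchet", crux]
def EternalRigidityViscBddOne : Prop :=
  ∀ R : ℝ, 1 ≤ R → Literature.Analysis.FluidPDE.TaoCascade.EternalRigidityViscBdd R 1

-- parent: EternalRigidityViscBddOne · child (gen 1)
/--     item stmt-NavierStokesRegularity-23197 · crux · rank 301 · open
    parent: EternalRigidityViscBddOne · by planner
    why it might fail: Bare strengthening-conjecture: only the DSS subclass is proved (periodicity = compactness); the action ratchet is no proof mechanism (critic P1: feeder heights decrease backward; small action vacuous, A_n≈5–17 in j293373). An intermittent finite-action eternal cascade kills the SPLIT only.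
    sources: Tao2016AveragedNS, arXiv:1402.0290, Ditlevsen2010 p.124, arXiv:2501.07377, kit:j293373
[crux, LINE g2-1 of ideator ns-idea-1 (technique: monotone quantity), split child (A) of the SHARED
K2ᵛ EternalRigidityViscBddOne = stmt-NavierStokesRegularity-20420] ACTION CEILING: below a
threshold, EVERY admissible viscous eternal solution (any ν̂ ≥ 0) of an E₂(R) table — admissible =
the clauses of IsEternalVisc: uniform per-shell ACTION ∫‖W_n(σ)‖dσ ≤ M and forward shell-energy
bounds — is UNIFORMLY BOUNDED (type-I in the renormalised variables of Tao 2016 §6.4). LEVER (new on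
rung TL-M2Break; nobody attacks K2ᵛ — host TaoLadderRungTwoBreak, WakeRatchet rev 1 and
LatticeTransitLiouville all import 20420 as-is and put their levers on the Liouville half K1ᵛ): the
cumulative per-shell action A_n(σ) = ∫_{-∞}^{σ}‖W_n‖ is monotone and uniformly CAPPED by M; with the
shell-energy identity E_k' = F_{k-1} − F_k − diss and the flux bound |F_k| ≤ 2C_AΛ⁻¹‖W_{k+1}‖E_k
(tree: hasDerivAt_physEnergy, abs_physFlux_le) a spike of height L at (n,σ₀) must be FED within
log-time O(1) (damping rate 1) by shell n−1, whose feeding burst has height ≥ L/(C Λ M) because its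
action is ≤ M — a fed-spike RATCHET down the ladder that the far-past smallness of admissible
solutions terminates. Prototype = the -/
@[route_item "route-NavierStokesRegularity-WakeRatchet"]
def AdmissibleEternalBound : Prop :=
  ∀ R : ℝ, 1 ≤ R → ∃ εs : ℝ, 0 < εs ∧ ∀ ε₀ : ℝ, 0 < ε₀ → ε₀ ≤ εs → ∀ α : Fin 4 → Fin 4 → Fin 4 → ℤ × ℤ × ℤ → ℝ, Literature.Analysis.FluidPDE.TaoCascade.InTableClass R α → ∀ (νh : ℝ) (W : ℤ → ℝ → Literature.Analysis.FluidPDE.TaoCascade.Em 4), Literature.Analysis.FluidPDE.TaoCascade.IsEternalVisc ε₀ νh α W → Literature.Analysis.FluidPDE.TaoCascade.UniformBound W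

-- parent: EternalRigidityViscBddOne · child (gen 1)
/--     item stmt-NavierStokesRegularity-23198 · crux · rank 302 · open
    parent: EternalRigidityViscBddOne · by planner
    why it might fail: Inherits N-39: a robust blow-up whose front lags the self-similar clock (type-II-like / log-time chaotic) has unbounded renormalisation and no locally uniform limit; robustness does not pin the clock (admissible defects are dissipation-scale: relative power K₁L/√p_n → 0 along a surviving cascade).
    sources: Tao2016AveragedNS, arXiv:1402.0290, KochNadirashviliSereginSverak2009, kit:j293373
[crux, LINE g2-1 of ideator ns-idea-1, split child (B) of the shared K2ᵛ
stmt-NavierStokesRegularity-20420] UNBOUNDED EXTRACTION: below a threshold, robust blow-up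
(NoGlobalCascade ε₀ α X₀) of an E₂(R) table from a one-shell datum forces SOME admissible viscous
eternal solution (IsEternalVisc ε₀ ν̂ α W, any ν̂ ≥ 0) surviving forward at a = 1
(EternalSurvivingFwd 1) — the tree predicate EternalRigidityVisc R 1, i.e. the parent WITHOUT the
UniformBound clause (parent ⇒ this: tree eternalRigidityVisc_of_bdd); child (A) restores the bound,
glue (A) → (B) → parent is six lines (Sketch.lean split_glue, kernel-checked). What it isolates: the
ω-limit extraction in the log-time variables modulo shell shift needs only LOCAL compactness from
the physical energy bound ‖X_k‖ ≤ √E plus the clock «the front does not lag the self-similar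
schedule by an unbounded number of shells» to deliver admissibility (finite action) — the type-I
envelope is no longer asked of the extraction. Consequence-crux like the parent (the rung Target
implies it vacuously); MODEL lattice only, nothing about NS. CHEAPEST FALSIFIER / INSTRUMENT ROW:
the same kit run as child (A): a sub-threshold robust blow-up whose front -/
@[route_item "route-NavierStokesRegularity-WakeRatchet"]
def EternalRigidityViscOne : Prop :=
  ∀ R : ℝ, 1 ≤ R → Literature.Analysis.FluidPDE.TaoCascade.EternalRigidityVisc R 1

-- parent: EternalRigidityViscBddOne · glue (gen 1)
/--     item stmt-NavierStokesRegularity-23199 · support · rank 303 · closed · proved by Summit.NavierStokesRegularity.NavierStokesRegularity.Theorems.wakeRatchet_eternalRigidityViscBddOneOfActionSplit_proof (prover)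
    parent: EternalRigidityViscBddOne · GLUE: children ⟹ parent · by planner
ACTION-CEILING SPLIT of the shared K2ᵛ (stmt-NavierStokesRegularity-20420) by ideator ns-idea-1 LINE
g2-1: AdmissibleEternalBound → EternalRigidityViscOne → EternalRigidityViscBddOne. PROVABLE NOW in
six lines (folder line3/Sketch.lean split_glue, kernel-checked): intro R hR; take the min of the two
thresholds; child (B) gives ν̂, W admissible and surviving; child (A) gives UniformBound W. Model
lattice only; nothing about NS. -/
@[route_item "route-NavierStokesRegularity-WakeRatchet"]
def EternalRigidityViscBddOneOfActionSplit : Prop :=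
  AdmissibleEternalBound → EternalRigidityViscOne → EternalRigidityViscBddOne

-- `EternalRigidityViscBddOneOfActionSplit` holds: proved by `Summit.NavierStokesRegularity.NavierStokesRegularity.Theorems.wakeRatchet_eternalRigidityViscBddOneOfActionSplit_proof` (its module imports this route file, so no `_holds` link can be stated here).

/-- item stmt-NavierStokesRegularity-22743 · crux · rank 3 · open · by planner
why it might fail: The threshold may «breathe»: blow-ups at ν ↑ ν* could shadow an intermittent/heteroclinic threshold set with unbounded excursions of S_n (type-I constant → ∞), or runaway blow-up may fail to be open in ν so pinned trajectories never occur; Lemarié-Rieusset Q6 is open for NS.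
sources: Tao2016AveragedNS, doi:10.1201/b19556, doi:10.1016/j.jfa.2010.09.009, doi:10.1007/s00220-016-2593-z, doi:10.1007/s00208-012-0830-0, arXiv:2209.10203
[crux, LINE g8-1 of ideator ns-idea-1 (card «monotone quantity hunt»); CRITICAL-ELEMENT child (A) of
the shared K2ᵛbdd(1) EternalRigidityViscBddOne (stmt-20420); filed ALONGSIDE (add-only; a resplit is
tenure/operator business, requested on ladder-directors/REQUESTS.md) the action-ceiling split (A)
AdmissibleEternalBound (stmt-23197, verdict MISSTATED ×4 by ns-wake-p1 g5–g8, director-ns req126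
«never re-seat») / (B) EternalRigidityViscOne (stmt-23198)] MINIMAL VISCOUS BLOW-UP: below a
threshold, robust blow-up (NoGlobalCascade ε₀ α X₀) of an E₂(R) table forces, at SOME viscosity ν >
0, an EXACT ν-viscous lattice solution X from the same one-shell datum at shell 0 on [0,T) that is
CRITICALLY PINNED: (i) type-I Λⁿ(T−t)‖X_n(t)‖ ≤ C; (ii) uniform per-shell action Λⁿ∫₀ᵀ‖X_n‖dt ≤ C;
(iii)/(iv) two-sided pinning at the survival weight a = 1: (1+ε₀)ⁿ‖X_n(t)‖² ≤ C always and ≥ c at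
some t < T for EVERY shell n ≥ 0 (so every shell fires before T: blow-up at T). MECHANISM =
SELECTION, not a universal rate claim (this is how N-39 «robust blow-up may be type II / log-time
chaotic» is evaded): the family ν ↦ X^ν from (X₀, shell 0) has a THRESHOLD ν* := sup{ν : X^ν not
global-regular} ∈ (0,∞) — p -/
@[route_item "route-NavierStokesRegularity-WakeRatchet"]
def MinimalViscousBlowup : Prop :=
  ∀ R : ℝ, 1 ≤ R → ∃ εs : ℝ, 0 < εs ∧ ∀ ε₀ : ℝ, 0 < ε₀ → ε₀ ≤ εs → ∀ (α : Fin 4 → Fin 4 → Fin 4 → ℤ × ℤ × ℤ → ℝ) (X₀ : Fin 4 → ℝ), Literature.Analysis.FluidPDE.TaoCascade.InTableClass R α → Literature.Analysis.FluidPDE.TaoCascade.NoGlobalCascade ε₀ α X₀ → ∃ (ν T C c : ℝ) (X : Fin 4 → ℤ → ℝ → ℝ), 0 < ν ∧ 0 < T ∧ 0 < c ∧ (∀ i n, ContDiffOn ℝ 1 (X i n) (Set.Ico 0 T)) ∧ (∀ i n, X i n 0 = if n = 0 then X₀ i else 0) ∧ (∀ i n t, n < 0 → X i n t = 0) ∧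 (∀ i n t, 0 ≤ t → t < T → derivWithin (X i n) (Set.Ici 0) t = Literature.Analysis.FluidPDE.TaoCascade.quadTerm ε₀ α X i n t - ν * (1 + ε₀) ^ ((2 : ℝ) * n) * X i n t) ∧ (∀ (n : ℤ) (t : ℝ), 0 ≤ t → t < T → Literature.Analysis.FluidPDE.TaoCascade.bigLam ε₀ ^ n * (T - t) * ‖Literature.Analysis.FluidPDE.TaoCascade.shellVec X n t‖ ≤ C) ∧ (∀ n : ℤ, MeasureTheory.IntegrableOn (fun t => ‖Literature.Analysis.FluidPDE.TaoCascade.shellVec X n t‖) (Set.Ico 0 T) ∧ Literature.Analysis.FluidPDE.TaoCascade.bigLam ε₀ ^ n * (∫ t in Set.Ico 0 T, ‖Literature.Analysis.FluidPDE.TaoCascade.shellVec X n t‖) ≤ C) ∧ (∀ (n : ℤ) (t : ℝ), 0 ≤ t → t < T → (1 + ε₀) ^ n * ‖Literature.Analysis.FluidPDE.TaoCascade.shellVec X n t‖ ^ 2 ≤ C) ∧ (∀ n : ℤ, 0 ≤ n → ∃ t : ℝ, 0 ≤ t ∧ t < T ∧ c ≤ (1 + ε₀) ^ n * ‖Literature.Analysis.FluidPDE.TaoCascade.shellVec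 X n t‖ ^ 2)

/-- item stmt-NavierStokesRegularity-22744 · crux · rank 4 · closed · proved by Summit.NavierStokesRegularity.NavierStokesRegularity.Cruxes.MinimalBlowupExtraction.ClockedFrames.minimalBlowupExtraction (prover) · by planner
why it might fail: The lower clock T − t_m ≳ (1+ε₀)^{−2m} needs a no-instantaneous-firing lemma from the flux bound; if upper pinning does not bound the feed of shell m+1 (tableB cross terms with shell m+2), frames may degenerate (ν̂_j → ∞) and the recentred limit be trivial or lose its survival witnesses.
sources: Tao2016AveragedNS, KochNadirashviliSereginSverak2009, doi:10.1007/s00208-012-0830-0, doi:10.1201/b19556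
[crux (compactness half), LINE g8-1 of ideator ns-idea-1; CRITICAL-ELEMENT child (B) of the shared
K2ᵛbdd(1) EternalRigidityViscBddOne (stmt-20420)] MINIMAL BLOW-UP EXTRACTION: for an E₂(R) table
below a threshold, ANY exact ν-viscous solution X from a one-shell datum on [0,T) with the four
pinning clauses of MinimalViscousBlowup (type-I, uniform per-shell action, two-sided pinning at a =
1 with every shell firing) yields ν̂ ≥ 0 and a uniformly bounded admissible viscous eternal solution
W (IsEternalVisc ε₀ ν̂ α W ∧ UniformBound W) surviving forward at a = 1. SKETCH (why this is the
tractable half): renormalise W̃_n(σ) := Λⁿe^{−σ}X_n(T − e^{−σ}) — exact IsEternalVisc law with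
covariant viscosity ν(1+ε₀)^{2n}e^{−σ} on σ > −log T; recentre at the firing times t_m of clause
(iv): frames W⁽ʲ⁾_n(σ) = W̃_{n+m_j}(σ + s_j), s_j := −log(T − t_{m_j}); the TWO-SIDED CLOCK
κ₁(1+ε₀)^{−2m} ≤ T − t_m ≤ κ₂(1+ε₀)^{−2m} follows from type-I + lower pinning (upper bound) and from
the flux bound `abs_physFlux_le` + upper pinning (lower bound: shell m+1 needs time ≳ (1+ε₀)^{−2m}
to fire), so the frame viscosities ν̂_j = ν(1+ε₀)^{2m_j}e^{−s_j} stay in a fixed band; Arzelà–Ascoli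
shellwise (derivatives bo -/
@[route_item "route-NavierStokesRegularity-WakeRatchet"]
def MinimalBlowupExtraction : Prop :=
  ∀ R : ℝ, 1 ≤ R → ∃ εs : ℝ, 0 < εs ∧ ∀ ε₀ : ℝ, 0 < ε₀ → ε₀ ≤ εs → ∀ (α : Fin 4 → Fin 4 → Fin 4 → ℤ × ℤ × ℤ → ℝ) (X₀ : Fin 4 → ℝ), Literature.Analysis.FluidPDE.TaoCascade.InTableClass R α → ∀ (ν T C c : ℝ) (X : Fin 4 → ℤ → ℝ → ℝ), (0 < ν ∧ 0 < T ∧ 0 < c ∧ (∀ i n, ContDiffOn ℝ 1 (X i n) (Set.Ico 0 T)) ∧ (∀ i n, X i n 0 = if n = 0 then X₀ i else 0) ∧ (∀ i n t, n < 0 → X i n t = 0) ∧ (∀ i n t, 0 ≤ t → t < T → derivWithin (X i n) (Set.Ici 0) t = Literature.Analysis.FluidPDE.TaoCascade.quadTerm ε₀ α X i n t - ν * (1 + ε₀) ^ ((2 : ℝ) * n) * X i n t) ∧ (∀ (n : ℤ) (t : ℝ), 0 ≤ t → t < T → Literature.Analysis.FluidPDE.TaoCascade.bigLam ε₀ ^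 n * (T - t) * ‖Literature.Analysis.FluidPDE.TaoCascade.shellVec X n t‖ ≤ C) ∧ (∀ n : ℤ, MeasureTheory.IntegrableOn (fun t => ‖Literature.Analysis.FluidPDE.TaoCascade.shellVec X n t‖) (Set.Ico 0 T) ∧ Literature.Analysis.FluidPDE.TaoCascade.bigLam ε₀ ^ n * (∫ t in Set.Ico 0 T, ‖Literature.Analysis.FluidPDE.TaoCascade.shellVec X n t‖) ≤ C) ∧ (∀ (n : ℤ) (t : ℝ), 0 ≤ t → t < T → (1 + ε₀) ^ n * ‖Literature.Analysis.FluidPDE.TaoCascade.shellVec X n t‖ ^ 2 ≤ C) ∧ (∀ n : ℤ, 0 ≤ n → ∃ t : ℝ, 0 ≤ t ∧ t < T ∧ c ≤ (1 + ε₀) ^ n * ‖Literature.Analysis.FluidPDE.TaoCascade.shellVec X n t‖ ^ 2)) → ∃ (νh : ℝ) (W : ℤ → ℝ → Literature.Analysis.FluidPDE.TaoCascade.Em 4), Literature.Analysis.FluidPDE.TaoCascade.IsEternalVisc ε₀ νh α W ∧ Literature.Analysis.FluidPDE.TaoCascade.UniformBound W ∧ Literature.Analysis.FluidPDE.TaoCascade.EternalSurvivingFwd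 1 ε₀ W

-- `MinimalBlowupExtraction` holds: proved by `Summit.NavierStokesRegularity.NavierStokesRegularity.Cruxes.MinimalBlowupExtraction.ClockedFrames.minimalBlowupExtraction` (its module imports this route file, so no `_holds` link can be stated here).

/-- item stmt-NavierStokesRegularity-21808 · aside · rank 2 · open · by planner
why it might fail: A fixed-spread table may carry fronts whose stranded fraction → 0 as ε₀ → 0 (the Toda member T_ε ∈ E₂(2/ε) already forces w(R) ≤ C(2/R)², kit j280208), or a chaotic bounded eternal front (non-DSS Sabra-type attractor, arXiv:2501.07377 p.20) may strand arbitrarily little at a sparse set of shells.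
sources: Tao2016AveragedNS, arXiv:1402.0290, doi:10.1016/s0167-2789(97)80015-2, arXiv:1201.1631, arXiv:2501.07377, doi:10.1088/0951-7715/26/4/1105
RECORD NOTE (2026-08-27T22:12Z): the statement of record is rev 0, UNRESTRICTED (binds every
uniformly bounded admissible eternal solution, surviving or not); the History line '21:14Z rev 1:
restated TailRatchet … EternalSurvivingFwd' refers to edit tk-d0389fcd213b, which errored on the
farm (exit 75), was never applied, and is withdrawn (critic idea-crit-3 ADDENDUM 2; tribunal J).
[crux] for every spread R ≥ 1 there are w > 0 and ε_s > 0 such that for all ε₀ ∈ (0, ε_s], every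
table α ∈ InTableClass R (m = 4), every ν̂ and every admissible eternal solution W with
IsEternalVisc ε₀ ν̂ α W and UniformBound W, and every shell n: if the tail energy Σ_{k≥0} E_{n+k}(σ)
(E = physEnergy) is ≤ M at ALL log-times σ, then the next tail Σ_{k≥0} E_{n+1+k}(σ) is ≤ (1 − w)·M
at all log-times (the tail-energy envelope contracts by a spread-uniform factor per shell; its
monotonicity is free). [difficulty: XL] -/
@[route_item "route-NavierStokesRegularity-WakeRatchet", crux]
def TailRatchet : Prop :=
  ∀ R : ℝ, 1 ≤ R → ∃ w : ℝ, 0 < w ∧ ∃ εs : ℝ, 0 < εs ∧ ∀ ε₀ : ℝ, 0 < ε₀ → ε₀ ≤ εs → ∀ α : Fin 4 → Fin 4 → Fin 4 → ℤ × ℤ × ℤ → ℝ, Literature.Analysis.FluidPDE.TaoCascade.InTableClass R α → ∀ (νh : ℝ) (W : ℤ → ℝ → Literature.Analysis.FluidPDE.TaoCascade.Em 4), Literature.Analysis.FluidPDE.TaoCascade.IsEternalVisc ε₀ νh α W → Literature.Analysis.FluidPDE.TaoCascade.UniformBound W → ∀ (n : ℤ) (M : ℝ), (∀ σ : ℝ,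 ∑' k : ℕ, Literature.Analysis.FluidPDE.TaoCascade.physEnergy ε₀ W (n + k) σ ≤ M) → ∀ σ : ℝ, ∑' k : ℕ, Literature.Analysis.FluidPDE.TaoCascade.physEnergy ε₀ W (n + 1 + k) σ ≤ (1 - w) * M

/-- item stmt-NavierStokesRegularity-21809 · support · rank 9 · closed · proved by Summit.NavierStokesRegularity.NavierStokesRegularity.Theorems.wakeRatchet_tailEnvelopeFinite_proof (prover) · by planner
sources: Tao2016AveragedNS, arXiv:1402.0290
[support] for every admissible eternal solution W (IsEternalVisc ε₀ ν̂ α W, 0 < ε₀) with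
UniformBound on a CANCELLING table, every tail energy Σ_{k≥0} E_{n+k}(σ) is bounded uniformly in σ.
Proof route (M-sized real analysis): the finite tail Σ_{k=n}^{K} E_k has derivative F_{n−1} − F_K −
dissipation (`hasDerivAt_physEnergy`); |F_K(σ)| ≤ c·Λ^{−2K}e^{2σ}C³ → 0 (UniformBound); forward,
|F_{n−1}(σ)| ≤ c'e^{−σ} by `IsEternalVisc.bdd` at shells n−1, n; backward, the tail is ≤
e^{2σ}C²Λ^{−2n}/(1 − Λ^{−2}). [difficulty: M] -/
@[route_item "route-NavierStokesRegularity-WakeRatchet", crux]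
def TailEnvelopeFinite : Prop :=
  ∀ (ε₀ νh : ℝ) (α : Fin 4 → Fin 4 → Fin 4 → ℤ × ℤ × ℤ → ℝ) (W : ℤ → ℝ → Literature.Analysis.FluidPDE.TaoCascade.Em 4), 0 < ε₀ → Literature.Analysis.FluidPDE.TaoCascade.IsCancellingCoeff α → Literature.Analysis.FluidPDE.TaoCascade.IsEternalVisc ε₀ νh α W → Literature.Analysis.FluidPDE.TaoCascade.UniformBound W → ∀ n : ℤ, ∃ M : ℝ, ∀ σ : ℝ, ∑' k : ℕ, Literature.Analysis.FluidPDE.TaoCascade.physEnergy ε₀ W (n + k) σ ≤ M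

-- `TailEnvelopeFinite` holds: proved by `Summit.NavierStokesRegularity.NavierStokesRegularity.Theorems.wakeRatchet_tailEnvelopeFinite_proof` (its module imports this route file, so no `_holds` link can be stated here).

/-- item stmt-NavierStokesRegularity-21810 · support · rank 9 · closed · proved by Summit.NavierStokesRegularity.NavierStokesRegularity.Theorems.wakeRatchet_ratchetStarvation_proof (prover) · by planner
sources: Tao2016AveragedNS, arXiv:1402.0290
[support] a=1 bookkeeping, provable now: if an admissible eternal solution W (IsEternalVisc ε₀ ν̂ α
W, UniformBound W) has finite tail envelopes and the tail contraction of crux 2 at some w > 0 with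
(1+ε₀)(1−w) < 1, then W is not forward (S₁)-surviving. Proof sketch: Θ_0 := the bound at shell 0;
induction on j ≥ 0 gives Σ_k E_{j+k} ≤ (1−w)^j Θ_0 at all σ; E_j ≤ its tail (summable by
UniformBound, terms ≥ 0); the weighted energy p_j = (1+ε₀)^j E_j (`wtEnergy_eq`) is ≤
((1+ε₀)(1−w))^j Θ_0 → 0, contradicting EternalSurvivingFwd 1 (a level c > 0 reached at arbitrarily
high shells). [difficulty: provable-now] -/
@[route_item "route-NavierStokesRegularity-WakeRatchet", crux]
def RatchetStarvation : Prop :=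
  ∀ (ε₀ w νh : ℝ) (α : Fin 4 → Fin 4 → Fin 4 → ℤ × ℤ × ℤ → ℝ) (W : ℤ → ℝ → Literature.Analysis.FluidPDE.TaoCascade.Em 4), 0 < ε₀ → 0 < w → (1 + ε₀) * (1 - w) < 1 → Literature.Analysis.FluidPDE.TaoCascade.IsEternalVisc ε₀ νh α W → Literature.Analysis.FluidPDE.TaoCascade.UniformBound W → (∀ n : ℤ, ∃ M : ℝ, ∀ σ : ℝ, ∑' k : ℕ, Literature.Analysis.FluidPDE.TaoCascade.physEnergy ε₀ W (n + k) σ ≤ M) → (∀ (n : ℤ) (M : ℝ), (∀ σ : ℝ, ∑' k : ℕ, Literature.Analysis.FluidPDE.TaoCascade.physEnergy ε₀ W (n + k) σ ≤ M) → ∀ σ : ℝ, ∑' k : ℕ, Literature.Analysis.FluidPDE.TaoCascade.physEnergy ε₀ W (n + 1 + k) σ ≤ (1 - w) * M) → ¬ Literature.Analysis.FluidPDE.TaoCascade.EternalSurvivingFwd 1 ε₀ W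

-- `RatchetStarvation` holds: proved by `Summit.NavierStokesRegularity.NavierStokesRegularity.Theorems.wakeRatchet_ratchetStarvation_proof` (its module imports this route file, so no `_holds` link can be stated here).

/-- item stmt-NavierStokesRegularity-22745 · support · rank 9 · closed · proved by Summit.NavierStokesRegularity.NavierStokesRegularity.Theorems.wakeRatchet_eternalRigidityViscBddOneOfMinimalBlowup_proof (prover) · by planner
why it might fail: none — pure logic, proved in the line folder (Sketch.lean rc 0, 0 sorry).
sources: Tao2016AveragedNS
[support, provable NOW in six lines — kernel-checked sorry-free in the ideator's folder
lines/g8-1/Sketch.lean `eternalRigidityViscBddOne_of_minimalBlowup` (HOME copy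
run/shared/lean/pub/ideators/ns-idea-1/lines/g8-1/): intro R hR; εs := min εs₁ εs₂; modus ponens]
the CRITICAL-ELEMENT DECOMPOSITION of the shared K2ᵛbdd(1) EternalRigidityViscBddOne (stmt-20420,
binder h₄ of closes): MinimalViscousBlowup ∧ MinimalBlowupExtraction ⇒ K2ᵛbdd(1). LINE g8-1 of
ideator ns-idea-1; an ALTERNATIVE decomposition to the action-ceiling split (AdmissibleEternalBound
23197 [MISSTATED ×4] / EternalRigidityViscOne 23198), registered also as a skeleton line on
stmt-20420 so every route wanting K2ᵛbdd(1) sees it. Model lattice only. No summit is proved by a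
line. -/
@[route_item "route-NavierStokesRegularity-WakeRatchet"]
def EternalRigidityViscBddOneOfMinimalBlowup : Prop :=
  MinimalViscousBlowup → MinimalBlowupExtraction → EternalRigidityViscBddOne

-- `EternalRigidityViscBddOneOfMinimalBlowup` holds: proved by `Summit.NavierStokesRegularity.NavierStokesRegularity.Theorems.wakeRatchet_eternalRigidityViscBddOneOfMinimalBlowup_proof` (its module imports this route file, so no `_holds` link can be stated here).

/-- item stmt-NavierStokesRegularity-23619 · support · rank 9 · open · by planner
[support] FIRST RUNG of AdmissibleEternalBound (stmt-23197; special case, glue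
`nondegenerateTransferBound_of_admissibleEternalBound` in the planner sketch): on R-comparable
tables whose OUTFLOW FORM is non-degenerate (‖tableA α x‖ ≥ c‖x‖² — no dead directions: every state
seeds the shell above at full rate; generic within E₂(R) since four quadrics in ℙ³ have no common
zero, but FALSE for sparse circuit tables such as Tao’s) every admissible viscous eternal solution
is uniformly bounded. Lever: an unbounded renormalisation needs STALLS (epochs where a shell holds
its energy for ≫ one turnover, equivalently W ≫ 1 — else the cascade from a fast shell would finish
before t⋆), and a stall needs the held state to linger near a dead direction of the outflow
(stop-and-go / heteroclinic-lingering scenario: the concrete enemy of 23197 and the mechanism behind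
N-39); non-degenerate outflow leaves no dead direction. Why it might fail: SLOSHING — the flux
Λ⟨A(W_n),W_{n+1}⟩ can oscillate in sign under the intra-shell rotation Q, stalling the cascade with
non-degenerate outflow. Regime not covered by the DSS prototype (all admissible solutions, non-DSS
included). MODEL lattice only; nothing abou -/
@[route_item "route-NavierStokesRegularity-WakeRatchet"]
def NondegenerateTransferBound : Prop :=
  ∀ R : ℝ, 1 ≤ R → ∀ c : ℝ, 0 < c → ∃ εs : ℝ, 0 < εs ∧ ∀ ε₀ : ℝ, 0 < ε₀ → ε₀ ≤ εs → ∀ α : Fin 4 → Fin 4 → Fin 4 → ℤ × ℤ × ℤ → ℝ, Literature.Analysis.FluidPDE.TaoCascade.InTableClass R α → (∀ x : Literature.Analysis.FluidPDE.TaoCascade.Em 4, c * ‖x‖ ^ 2 ≤ ‖Literature.Analysis.FluidPDE.TaoCascade.tableA α x‖) → ∀ (νh : ℝ) (W : ℤ → ℝ → Literature.Analysis.FluidPDE.TaoCascade.Em 4), Literature.Analysis.FluidPDE.TaoCascade.IsEternalVisc ε₀ νh α W → Literature.Analysis.FluidPDE.TaoCascade.UniformBound W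

/-- item stmt-NavierStokesRegularity-21811 · assembly · rank 1 · closed · proved by Summit.NavierStokesRegularity.NavierStokesRegularity.Theorems.wakeRatchet_assembly_proof (prover) · by planner
sources: Tao2016AveragedNS, arXiv:1402.0290
[assembly] TailRatchet → TailEnvelopeFinite → RatchetStarvation → EternalRigidityViscBddOne → the
rung leaf TL-M2Break (TaoLadderRungTwoBreak.Target; NOT the summit). -/
@[route_item "route-NavierStokesRegularity-WakeRatchet"]
def Assembly : Prop :=
  TailRatchet → TailEnvelopeFinite → RatchetStarvation → EternalRigidityViscBddOne → Summit.NavierStokesRegularity.NavierStokesRegularity.Theses.TaoLadderRungTwoBreak.Target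

-- `Assembly` holds: proved by `Summit.NavierStokesRegularity.NavierStokesRegularity.Theorems.wakeRatchet_assembly_proof` (its module imports this route file, so no `_holds` link can be stated here).

/-! D-0027 §2.1 — DECIDING THEOREM (planner-authored via `route open/edit --closes-file`; by planner-ns-idea-1-g4-0 2026-08-28T04:09:59Z):
its hypotheses are this route's items and its conclusion the registered leaf `Summit.NavierStokesRegularity.NavierStokesRegularity.Theses.TaoLadderRungTwoBreak.Target` (rung TL-M2Break, D-0061) (glue_lint), and it elaborates with this file. -/

@[closes "route-NavierStokesRegularity-WakeRatchet"] theorem closes (h₁ : TailRateRatchet) (h₂ : TailEnvelopeFinite) (h₃ : RatchetStarvation)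
    (h₄ : EternalRigidityViscBddOne) :
    Summit.NavierStokesRegularity.NavierStokesRegularity.Theses.TaoLadderRungTwoBreak.Target := by
  intro R hR
  refine Literature.Analysis.FluidPDE.TaoCascade.noRobustBlowupBelow_of_eternalViscBdd ?_ (h₄ R hR)
  obtain ⟨a, ha, εs, hεs, H⟩ := h₁ R hR
  refine ⟨εs, hεs, ?_⟩
  intro ε₀ hε₀ hle α hα νh W hW hU
  have hb : (1 : ℝ) < 1 + ε₀ := by linarith
  have hb0 : (0 : ℝ) < 1 + ε₀ := by linarith
  have hw : 0 < 1 - (1 + ε₀) ^ (-a) := by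
    have : (1 + ε₀) ^ (-a) < 1 := Real.rpow_lt_one_of_one_lt_of_neg hb (by linarith)
    linarith
  have hprod : (1 + ε₀) * (1 - (1 - (1 + ε₀) ^ (-a))) < 1 := by
    have e : (1 + ε₀) * (1 - (1 - (1 + ε₀) ^ (-a))) = (1 + ε₀) ^ (1 - a) := by
      rw [sub_sub_cancel, Real.rpow_sub hb0, Real.rpow_one, Real.rpow_neg hb0.le, div_eq_mul_inv]
    rw [e]
    exact Real.rpow_lt_one_of_one_lt_of_neg hb (by linarith)
  refine h₃ ε₀ (1 - (1 + ε₀) ^ (-a)) νh α W hε₀ hw hprod hW hU (h₂ ε₀ νh α W hε₀ hα.2.1 hW hU) ?_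
  intro n M hM σ
  have h1 := H ε₀ hε₀ hle α hα νh W hW hU n M hM σ
  rwa [sub_sub_cancel]

end Summit.NavierStokesRegularity.NavierStokesRegularity.Theses.WakeRatchet
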